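import Summits.QuantumAdvantage.QuantumAdvantage.Theorems.CubicForrelationNearExactIsExactKtThreeStructure
import Summits.QuantumAdvantage.QuantumAdvantage.Theorems.CubicForrelationNearExactIsExactSecondWeightAll
import Summits.QuantumAdvantage.QuantumAdvantage.Theorems.CubicForrelationSignedExactSliceIsLiftStubMoebius
import Summits.QuantumAdvantage.QuantumAdvantage.Theorems.CubicForrelationSignedCubicForrelationNotPrBPPStubKernelNormalFormDegree

/-!
# Crux `CubicForrelation.NearExactIsExact` (stmt-QuantumAdvantage-14043) — Kasami–Tokura at weight `1.5·d_min` for EVERY order, I: tools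

Certificate seat `b2b-cforr-cert` (gen 44).  HONEST FRAMING: elementary coding-theory TOOLS (standard axioms, no `decide` on data, uniform in
the number of bits `m` and in the order) for the brick `…KtHalfStructure.lean`: **a Boolean function of degree `≤ r` on `m` bits with EXACTLY
`3·2^{m−r−1}` ones (one and a half times the minimum weight of `RM(r,m)`) is, coordinate-free, `(A₀A₁ ⊕ A₂A₃) ∧ P₀ ∧ ⋯ ∧ P_{r−3}` with
affine `Aᵢ, Pⱼ` admitting a dual family of translation vectors** — the weight-`1.5d` case of Kasami–Tokura's theorem (1970, Thm 1: type
`x₁⋯x_{r−2}(x_{r−1}x_r ⊕ x_{r+1}x_{r+2})`), which the tree so far has only for `r = 3` (`kt3_structure`, `kt3_hyperplane_form`).  Intended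
consumers are the three structure questions left open at `n = 14` (DISPROOF.md §18.3 line `29/32`: `f ⊕ g̃` of weight `768` in `RM(5,14)`;
§32.5 configuration T′: `#E = 1536` in `RM(4,14)`; §32.4 (L′b): `#P = 6144` in `RM(2,14)`).  NOT summit progress; nothing about `θ₁₄` is
claimed here.

* `kh_affine_shift`: an affine function changes by a constant under translation.
* `kh_hyperplane_form`: `kt3_hyperplane_form` for an ABSTRACT affine hyperplane `{L = 1}` given with a flipping vector `u`
  (`L(x ⊕ u) = ¬L(x)`): a function of degree `≤ d+1` supported in `{L = 1}` is `L ∧ (c ⊕ c(·⊕u))`, the derivative having degree `≤ d`,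
  period `u` and twice the ones.
* `kh_disjoint_of_card`: if `c ⊕ c(·⊕a)` has `2·#E` ones then `E` and `E ⊕ a` are disjoint.
* `kh_exists_double_derivative`: for degree `≤ s+3` and `2^{s+4}·#E = 3·2^m` SOME derivative has `2·#E` ones (second weight of order
  `s+2`, `sw_second_weight_all`, on every derivative + the double count `Σ_a #(E Δ (E⊕a)) = 2#E(2^m − #E)`: if every translate met `E`
  in `≥ d/2` points then `2^{s+4} ≤ 9`).
* `kh_pattern`, `kh_nf_invariant`, `kh_dual_adjust`: bookkeeping of the normal form `(A₀A₁ ⊕ A₂A₃) ∧ ⋀ⱼ Pⱼ` with a dual family: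
  prescribing the `A`-values inside `{P = 1}`; a period of the normal form fixes every `Aᵢ`, `Pⱼ`; adjusting a dual vector by a transversal
  `u` so that it also fixes a new hyperplane `L`.

References: T. Kasami, N. Tokura, *On the weight structure of Reed–Muller codes*, IEEE Trans. IT 16 (1970) 752–759, Thm 1;
F. J. MacWilliams, N. J. A. Sloane (1977) Ch. 15 §3.  Everything is proved from Mathlib and the tree; axioms: the standard three.
-/

set_option linter.dupNamespace false -- D-0017: single-problem summit ⇒ `QuantumAdvantage.QuantumAdvantage` by design

noncomputable section

namespace Summit.QuantumAdvantage.QuantumAdvantage.Theorems.CubicForrelation.NearExactIsExact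

open Finset
open Literature.Computability.QuantumComplexity
open Literature.Computability.QuantumComplexity.BuzetChailloux (bxor zeroVec bxor_self bxor_zeroVec zeroVec_bxor bxor_comm
  bxor_bxor_cancel_left)

variable {m : ℕ}

/-! ### Affine functions under translation -/

/-- An affine Boolean function (degree `≤ 1`) changes by a CONSTANT under any translation: `ℓ(x ⊕ t) = ℓ(x) ⊕ ε(t)`. [folklore] -/
theorem kh_affine_shift (ℓ : (Fin m → Bool) → Bool) (hℓ : IsDegLeFun 1 ℓ) (t : Fin m → Bool) :
    ∃ ε : Bool, ∀ x, ℓ (bxor x t) = (ℓ x ^^ ε) := by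
  have h0 : IsDegLeFun 0 (fun x => ℓ x ^^ ℓ (bxor x t)) := stub_derivDegree m 0 ℓ t hℓ
  refine ⟨ℓ zeroVec ^^ ℓ (bxor zeroVec t), fun x => ?_⟩
  have h := tc_const_of_deg_zero h0 x zeroVec
  revert h
  cases ℓ x <;> cases ℓ (bxor x t) <;> cases ℓ zeroVec <;> cases ℓ (bxor zeroVec t) <;> decide

/-! ### The factorised form over an abstract affine hyperplane -/

/-- **Factorised form of a hyperplane-supported function, abstract hyperplane.**  Let `c : 𝔽₂^m → 𝔽₂` have degree `≤ d + 1` and support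
inside `{L = 1}`, where `L` flips under the translation `u` (`L(x ⊕ u) = ¬L(x)`).  Then the derivative `q = c ⊕ c(·⊕u)` has degree `≤ d`,
is `u`-periodic, has twice as many ones as `c`, the support of `c` misses its `u`-translate, and `c(x) = L(x) ∧ q(x)` for every `x`
(Kasami–Tokura's type `x₁·q`, coordinate-free). [this work; cite: KasamiTokura1970, Thm 1] -/
theorem kh_hyperplane_form {d : ℕ} (c : (Fin m → Bool) → Bool) (hc : IsDegLeFun (d + 1) c)
    (L : (Fin m → Bool) → Bool) (u : Fin m → Bool) (hLu : ∀ x, L (bxor x u) = !L x)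
    (hE : ∀ x, c x = true → L x = true) :
    IsDegLeFun d (fun x => c x ^^ c (bxor x u)) ∧
      (∀ x, (c (bxor x u) ^^ c (bxor (bxor x u) u)) = (c x ^^ c (bxor x u))) ∧
      #(univ.filter fun x => (c x ^^ c (bxor x u)) = true) = 2 * #(univ.filter fun x => c x = true) ∧
      (∀ x, c x = true → c (bxor x u) = false) ∧
      ∀ x, c x = (L x && (c x ^^ c (bxor x u))) := by
  classical
  set S := univ.filter (fun x : Fin m → Bool => c x = true) with hSdef
  have hcv : ∀ x, c x = true → c (bxor x u) = false := by
    intro x hx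
    by_contra h
    rw [Bool.not_eq_false] at h
    have h1 := hE x hx
    have h2 := hE (bxor x u) h
    rw [hLu, h1] at h2
    exact Bool.false_ne_true h2
  refine ⟨stub_derivDegree m d c u hc, fun x => ?_, ?_, hcv, fun x => ?_⟩
  · rw [iw_bxor_assoc, bxor_self, bxor_zeroVec, Bool.xor_comm]
  · have e : (univ.filter fun x => (c x ^^ c (bxor x u)) = true) = S ∪ univ.filter (fun x => c (bxor x u) = true) := by
      ext x
      simp only [hSdef, mem_union, mem_filter, mem_univ, true_and]
      constructor
      · cases hx : c x <;> cases hx' : c (bxor x u) <;> simp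
      · rintro (hx | hx)
        · rw [hx, hcv x hx]; rfl
        · have : c x = false := by
            have := hcv _ hx; rwa [iw_bxor_assoc, bxor_self, bxor_zeroVec] at this
          rw [this, hx]; rfl
    have hdisj : Disjoint S (univ.filter fun x => c (bxor x u) = true) := by
      rw [hSdef, disjoint_filter]; intro x _ hx hx'; rw [hcv x hx] at hx'; exact Bool.false_ne_true hx'
    rw [e, card_union_of_disjoint hdisj]
    have : #(univ.filter fun x => c (bxor x u) = true) = #S := by
      refine card_nbij' (fun x => bxor x u) (fun x => bxor x u) (fun x hx => ?_) (fun x hx => ?_)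
        (fun x _ => by simp [iw_bxor_assoc]) (fun x _ => by simp [iw_bxor_assoc])
      · rw [mem_coe, mem_filter] at hx; exact mem_filter.2 ⟨mem_univ _, hx.2⟩
      · rw [mem_coe, mem_filter] at hx ⊢
        refine ⟨mem_univ _, ?_⟩
        rw [iw_bxor_assoc, bxor_self, bxor_zeroVec]; exact hx.2
    rw [this]; ring
  · by_cases hx : c x = true
    · rw [hx, hcv x hx, hE x hx]; rfl
    · have hx' : c x = false := by simpa using hx
      rw [hx']
      by_cases hxu : c (bxor x u) = true
      · have h2 := hE (bxor x u) hxu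
        rw [hLu] at h2
        have : L x = false := by revert h2; cases L x <;> simp
        rw [this, hxu]; rfl
      · have : c (bxor x u) = false := by simpa using hxu
        rw [this]; cases L x <;> rfl

/-! ### Disjoint translates from the derivative weight -/

/-- If the derivative `e ⊕ e(·⊕a)` has exactly `2·#E` ones (`E = {e = 1}`), then `E` and `E ⊕ a` are DISJOINT. [folklore] -/
theorem kh_disjoint_of_card (e : (Fin m → Bool) → Bool) (a : Fin m → Bool)
    (h : #(univ.filter fun x => (e x ^^ e (bxor x a)) = true) = 2 * #(univ.filter fun x => e x = true)) :
    ∀ x, e x = true → e (bxor x a) = false := by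
  classical
  set T := univ.filter (fun x : Fin m → Bool => e x = true ∧ e (bxor x a) = false) with hT
  set I := univ.filter (fun x : Fin m → Bool => e x = true ∧ e (bxor x a) = true) with hI
  set T' := univ.filter (fun x : Fin m → Bool => e x = false ∧ e (bxor x a) = true) with hT'
  have hS : #(univ.filter fun x => e x = true) = #I + #T := by
    rw [← card_union_of_disjoint]
    · congr 1; ext x
      simp only [mem_filter, mem_univ, true_and, mem_union, hI, hT]
      cases e (bxor x a) <;> simp
    · rw [hI, hT, disjoint_filter]; intro x _ h1 h2; exact Bool.false_ne_true (h2.2.symm.trans h1.2)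
  have hTT' : #T' = #T := by
    refine card_nbij' (fun x => bxor x a) (fun x => bxor x a) (fun x hx => ?_) (fun x hx => ?_)
      (fun x _ => by simp [iw_bxor_assoc]) (fun x _ => by simp [iw_bxor_assoc])
    · rw [mem_coe, mem_filter] at hx ⊢
      beta_reduce
      refine ⟨mem_univ _, hx.2.2, ?_⟩
      rw [iw_bxor_assoc, bxor_self, bxor_zeroVec]; exact hx.2.1
    · rw [mem_coe, mem_filter] at hx ⊢
      beta_reduce
      refine ⟨mem_univ _, hx.2.2, ?_⟩
      rw [iw_bxor_assoc, bxor_self, bxor_zeroVec]; exact hx.2.1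
  have hD : #(univ.filter fun x => (e x ^^ e (bxor x a)) = true) = #T + #T' := by
    rw [← card_union_of_disjoint]
    · congr 1; ext x
      simp only [mem_filter, mem_univ, true_and, mem_union, hT, hT']
      cases e x <;> cases e (bxor x a) <;> simp
    · rw [hT, hT', disjoint_filter]; intro x _ h1 h2; exact Bool.false_ne_true (h2.1.symm.trans h1.1)
  have hI0 : #I = 0 := by omega
  intro x hx
  by_contra hxa
  rw [Bool.not_eq_false] at hxa
  have hmem : x ∈ I := mem_filter.2 ⟨mem_univ _, hx, hxa⟩
  rw [card_eq_zero] at hI0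
  rw [hI0] at hmem
  simp at hmem

/-! ### A derivative with twice the ones exists at weight `1.5·d_min` (order `≥ 3`) -/

/-- **Some translate is disjoint.**  If `e : 𝔽₂^m → 𝔽₂` has degree `≤ s + 3` and exactly `3·2^{m−s−4}` ones (`2^{s+4}·#E = 3·2^m`, one and
a half times the minimum weight of `RM(s+3,m)`), then some derivative `e ⊕ e(·⊕a)` has exactly `2·#E` ones.  Proof: otherwise every
derivative (degree `≤ s+2`, at most `2#E` ones, hence `2^{s+3}·wt < 3·2^m`) is `0` or a minimum-weight word of `RM(s+2,m)` (`sw_second_weight_all`),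
so `2^{s+2}·wt ≤ 2^m`; summing over `a` with `Σ_a wt = 2#E(2^m − #E)` gives `2^{s+4} ≤ 9`. [this work; cite: KasamiTokura1970, Thm 1] -/
theorem kh_exists_double_derivative (s : ℕ) (e : (Fin m → Bool) → Bool) (he : IsDegLeFun (s + 3) e)
    (hw : 2 ^ (s + 4) * #(univ.filter fun x => e x = true) = 3 * 2 ^ m) :
    ∃ a, #(univ.filter fun x => (e x ^^ e (bxor x a)) = true) = 2 * #(univ.filter fun x => e x = true) := by
  classical
  set w := #(univ.filter fun x => e x = true) with hwdef
  by_contra hnone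
  push Not at hnone
  have hbound : ∀ a, 2 ^ (s + 2) * #(univ.filter fun x => (e x ^^ e (bxor x a)) = true) ≤ 2 ^ m := by
    intro a
    have hle : #(univ.filter fun x => (e x ^^ e (bxor x a)) = true) ≤ 2 * w := sw_deriv_card_le e a
    have hlt : #(univ.filter fun x => (e x ^^ e (bxor x a)) = true) < 2 * w := lt_of_le_of_ne hle (hnone a)
    by_cases h0 : #(univ.filter fun x => (e x ^^ e (bxor x a)) = true) = 0
    · rw [h0, mul_zero]; exact Nat.zero_le _
    · have hex : ∃ x, (e x ^^ e (bxor x a)) = true := by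
        by_contra hno
        push Not at hno
        apply h0
        rw [card_eq_zero, filter_eq_empty_iff]
        intro x _
        exact hno x
      have hdeg : IsDegLeFun (s + 2) (fun x => e x ^^ e (bxor x a)) := stub_derivDegree m (s + 2) e a he
      have h3 : 2 ^ (s + 2 + 1) * #(univ.filter fun x => (e x ^^ e (bxor x a)) = true) < 3 * 2 ^ m := by
        calc 2 ^ (s + 2 + 1) * #(univ.filter fun x => (e x ^^ e (bxor x a)) = true)
            < 2 ^ (s + 2 + 1) * (2 * w) := Nat.mul_lt_mul_of_pos_left hlt (by positivity)
          _ = 2 ^ (s + 4) * w := by rw [show s + 4 = (s + 2 + 1) + 1 by omega, pow_succ _ (s + 2 + 1)]; ring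
          _ = 3 * 2 ^ m := hw
      exact (sw_second_weight_all (s + 2) (by omega) m _ hdeg hex h3).le
  have hsum := sw_sum_deriv_card e
  have hM : #(univ : Finset (Fin m → Bool)) = 2 ^ m := by
    rw [card_univ, Fintype.card_fun, Fintype.card_bool, Fintype.card_fin]
  have htot : 2 ^ (s + 2) * (2 * w * (2 ^ m - w)) ≤ 2 ^ m * 2 ^ m := by
    rw [hwdef, ← hsum, mul_sum]
    calc ∑ a : Fin m → Bool, 2 ^ (s + 2) * #(univ.filter fun x => (e x ^^ e (bxor x a)) = true)
        ≤ ∑ _a : Fin m → Bool, 2 ^ m := sum_le_sum fun a _ => hbound a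
      _ = 2 ^ m * 2 ^ m := by rw [sum_const, smul_eq_mul, hM]
  have hwle : w ≤ 2 ^ m := by
    calc w ≤ #(univ : Finset (Fin m → Bool)) := card_le_univ _
      _ = 2 ^ m := hM
  -- arithmetic: `M = w + k`, `4·2^{s+2} = 2^{s+4}`, `2^{s+4} w = 3M`
  obtain ⟨k, hk⟩ : ∃ k, 2 ^ m = w + k := ⟨2 ^ m - w, by omega⟩
  have hT4 : 4 ≤ 2 ^ (s + 2) := by
    calc (4 : ℕ) = 2 ^ 2 := by norm_num
      _ ≤ 2 ^ (s + 2) := Nat.pow_le_pow_right (by norm_num) (by omega)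
  have hT : 2 ^ (s + 4) = 4 * 2 ^ (s + 2) := by
    rw [show s + 4 = (s + 2) + 2 by omega, pow_add]; ring
  rw [hk, Nat.add_sub_cancel_left] at htot
  rw [hT, hk] at hw
  -- `hw : 4 * 2^{s+2} * w = 3 * (w + k)`, `htot : 2^{s+2} * (2 * w * k) ≤ (w + k) * (w + k)`
  have hwpos : 0 < w := by
    rcases Nat.eq_zero_or_pos w with h0 | hpos
    · exfalso
      rw [h0, mul_zero] at hw
      have hp : 0 < 2 ^ m := by positivity
      omega
    · exact hpos
  -- (1) 16 w ≤ 3 (w + k)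
  have h1 : 16 * w ≤ 3 * (w + k) := by
    rw [← hw]
    have := Nat.mul_le_mul_right w hT4
    nlinarith [this]
  -- (2) from htot: 8 · (4 · 2^{s+2} · w) · k ≤ 16 (w+k)², i.e. 24 (w+k) k ≤ 16 (w+k)² ⇒ 24 k ≤ 16 (w + k)
  have h2 : (w + k) * (24 * k) ≤ (w + k) * (16 * (w + k)) := by
    have h16 := Nat.mul_le_mul_left 16 htot
    have e1 : 16 * (2 ^ (s + 2) * (2 * w * k)) = 8 * (4 * 2 ^ (s + 2) * w) * k := by ring
    rw [e1, hw] at h16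
    calc (w + k) * (24 * k) = 8 * (3 * (w + k)) * k := by ring
      _ ≤ 16 * ((w + k) * (w + k)) := h16
      _ = (w + k) * (16 * (w + k)) := by ring
  have hMpos : 0 < w + k := by omega
  have h3 : 24 * k ≤ 16 * (w + k) := Nat.le_of_mul_le_mul_left h2 hMpos
  omega

/-! ### Bookkeeping of the normal form `(A₀A₁ ⊕ A₂A₃) ∧ ⋀ⱼ Pⱼ` with a dual family -/

/-- **Prescribing the `A`-values.**  With a dual family (`vᵢ` flips `Aᵢ`, fixes the other `A`'s and every `Pⱼ`), from a point of
`{P = 1}` one reaches a point of `{P = 1}` with any prescribed values of `A₀,…,A₃`. [folklore] -/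
theorem kh_pattern {s : ℕ} (A : Fin 4 → (Fin m → Bool) → Bool) (P : Fin s → (Fin m → Bool) → Bool)
    (v : Fin 4 → Fin m → Bool)
    (hAv : ∀ i x, A i (bxor x (v i)) = !A i x) (hAv' : ∀ i k x, i ≠ k → A i (bxor x (v k)) = A i x)
    (hPv : ∀ j k x, P j (bxor x (v k)) = P j x)
    (x₀ : Fin m → Bool) (hx₀ : ∀ j, P j x₀ = true) (β₀ β₁ β₂ β₃ : Bool) :
    ∃ y, (∀ j, P j y = true) ∧ A 0 y = β₀ ∧ A 1 y = β₁ ∧ A 2 y = β₂ ∧ A 3 y = β₃ := by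
  -- one conditional shift along `v k`
  have step : ∀ (k : Fin 4) (b : Bool) (x : Fin m → Bool), (∀ j, P j x = true) →
      ∃ y, (∀ j, P j y = true) ∧ (∀ i, i ≠ k → A i y = A i x) ∧ A k y = b := by
    intro k b x hx
    by_cases h : A k x = b
    · exact ⟨x, hx, fun i _ => rfl, h⟩
    · refine ⟨bxor x (v k), fun j => by rw [hPv]; exact hx j, fun i hi => hAv' i k x hi, ?_⟩
      rw [hAv]
      revert h; cases A k x <;> cases b <;> simp
  obtain ⟨y₀, hy₀, hA₀, hb₀⟩ := step 0 β₀ x₀ hx₀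
  obtain ⟨y₁, hy₁, hA₁, hb₁⟩ := step 1 β₁ y₀ hy₀
  obtain ⟨y₂, hy₂, hA₂, hb₂⟩ := step 2 β₂ y₁ hy₁
  obtain ⟨y₃, hy₃, hA₃, hb₃⟩ := step 3 β₃ y₂ hy₂
  refine ⟨y₃, hy₃, ?_, ?_, ?_, hb₃⟩
  · rw [hA₃ 0 (by decide), hA₂ 0 (by decide), hA₁ 0 (by decide), hb₀]
  · rw [hA₃ 1 (by decide), hA₂ 1 (by decide), hb₁]
  · rw [hA₃ 2 (by decide), hb₂]

/-- **A period of the normal form fixes every factor.**  If `(A₀A₁ ⊕ A₂A₃) ∧ ⋀ⱼ Pⱼ` (affine `Aᵢ, Pⱼ` with a dual family for the `A`'s and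
`{P = 1} ≠ ∅`) is invariant under the translation `t`, then every `Aᵢ` and every `Pⱼ` is `t`-invariant. [this work] -/
theorem kh_nf_invariant {s : ℕ} (A : Fin 4 → (Fin m → Bool) → Bool) (P : Fin s → (Fin m → Bool) → Bool)
    (v : Fin 4 → Fin m → Bool)
    (hA : ∀ i, IsDegLeFun 1 (A i)) (hP : ∀ j, IsDegLeFun 1 (P j))
    (hAv : ∀ i x, A i (bxor x (v i)) = !A i x) (hAv' : ∀ i k x, i ≠ k → A i (bxor x (v k)) = A i x)
    (hPv : ∀ j k x, P j (bxor x (v k)) = P j x)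
    (x₀ : Fin m → Bool) (hx₀ : ∀ j, P j x₀ = true) (t : Fin m → Bool)
    (ht : ∀ x, ((((A 0 (bxor x t) && A 1 (bxor x t)) ^^ (A 2 (bxor x t) && A 3 (bxor x t))) &&
        decide (∀ j, P j (bxor x t) = true)) =
      ((((A 0 x && A 1 x) ^^ (A 2 x && A 3 x))) && decide (∀ j, P j x = true)))) :
    (∀ i x, A i (bxor x t) = A i x) ∧ (∀ j x, P j (bxor x t) = P j x) := by
  classical
  -- the `P`'s: a flipped `Pⱼ` would kill a point of the support
  have hPt : ∀ j x, P j (bxor x t) = P j x := by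
    intro j
    obtain ⟨ε, hε⟩ := kh_affine_shift (P j) (hP j) t
    cases ε
    · intro x; rw [hε, Bool.xor_false]
    · exfalso
      obtain ⟨y, hy, h0, h1, h2, h3⟩ := kh_pattern A P v hAv hAv' hPv x₀ hx₀ true true false false
      have h := ht y
      have hdec : decide (∀ j, P j y = true) = true := decide_eq_true hy
      rw [h0, h1, h2, h3, hdec] at h
      have h' : ((((A 0 (bxor y t) && A 1 (bxor y t)) ^^ (A 2 (bxor y t) && A 3 (bxor y t))) &&
          decide (∀ j, P j (bxor y t) = true)) = true) := h.trans (by decide)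
      rw [Bool.and_eq_true] at h'
      have hall := (of_decide_eq_true h'.2) j
      rw [hε, hy j] at hall
      exact Bool.false_ne_true hall
  refine ⟨?_, hPt⟩
  -- the `A`'s: compare the quadratic at `x₀` and at the four `x₀ ⊕ v_k`
  obtain ⟨ε₀, hε₀⟩ := kh_affine_shift (A 0) (hA 0) t
  obtain ⟨ε₁, hε₁⟩ := kh_affine_shift (A 1) (hA 1) t
  obtain ⟨ε₂, hε₂⟩ := kh_affine_shift (A 2) (hA 2) t
  obtain ⟨ε₃, hε₃⟩ := kh_affine_shift (A 3) (hA 3) t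
  have hQ : ∀ y, (∀ j, P j y = true) →
      (((A 0 y ^^ ε₀) && (A 1 y ^^ ε₁)) ^^ ((A 2 y ^^ ε₂) && (A 3 y ^^ ε₃))) = ((A 0 y && A 1 y) ^^ (A 2 y && A 3 y)) := by
    intro y hy
    have h := ht y
    have hd1 : decide (∀ j, P j y = true) = true := decide_eq_true hy
    have hd2 : decide (∀ j, P j (bxor y t) = true) = true :=
      decide_eq_true (fun j => by rw [hPt]; exact hy j)
    rw [hd1, hd2, Bool.and_true, Bool.and_true, hε₀, hε₁, hε₂, hε₃] at h
    exact h
  have hPx : ∀ k, ∀ j, P j (bxor x₀ (v k)) = true := fun k j => by rw [hPv]; exact hx₀ j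
  have e := hQ x₀ hx₀
  have e0 := hQ _ (hPx 0)
  have e1 := hQ _ (hPx 1)
  have e2 := hQ _ (hPx 2)
  have e3 := hQ _ (hPx 3)
  rw [hAv 0, hAv' 1 0 _ (by decide), hAv' 2 0 _ (by decide), hAv' 3 0 _ (by decide)] at e0
  rw [hAv 1, hAv' 0 1 _ (by decide), hAv' 2 1 _ (by decide), hAv' 3 1 _ (by decide)] at e1
  rw [hAv 2, hAv' 0 2 _ (by decide), hAv' 1 2 _ (by decide), hAv' 3 2 _ (by decide)] at e2
  rw [hAv 3, hAv' 0 3 _ (by decide), hAv' 1 3 _ (by decide), hAv' 2 3 _ (by decide)] at e3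
  have key : ∀ a0 a1 a2 a3 f0 f1 f2 f3 : Bool,
      (((a0 ^^ f0) && (a1 ^^ f1)) ^^ ((a2 ^^ f2) && (a3 ^^ f3))) = ((a0 && a1) ^^ (a2 && a3)) →
      (((!a0 ^^ f0) && (a1 ^^ f1)) ^^ ((a2 ^^ f2) && (a3 ^^ f3))) = ((!a0 && a1) ^^ (a2 && a3)) →
      (((a0 ^^ f0) && (!a1 ^^ f1)) ^^ ((a2 ^^ f2) && (a3 ^^ f3))) = ((a0 && !a1) ^^ (a2 && a3)) →
      (((a0 ^^ f0) && (a1 ^^ f1)) ^^ ((!a2 ^^ f2) && (a3 ^^ f3))) = ((a0 && a1) ^^ (!a2 && a3)) →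
      (((a0 ^^ f0) && (a1 ^^ f1)) ^^ ((a2 ^^ f2) && (!a3 ^^ f3))) = ((a0 && a1) ^^ (a2 && !a3)) →
      f0 = false ∧ f1 = false ∧ f2 = false ∧ f3 = false := by decide
  obtain ⟨k0, k1, k2, k3⟩ := key _ _ _ _ _ _ _ _ e e0 e1 e2 e3
  subst k0 k1 k2 k3
  intro i x
  fin_cases i
  · exact (hε₀ x).trans (Bool.xor_false _)
  · exact (hε₁ x).trans (Bool.xor_false _)
  · exact (hε₂ x).trans (Bool.xor_false _)
  · exact (hε₃ x).trans (Bool.xor_false _)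

/-- **Adjusting a translation to fix a new hyperplane.**  If `L` is affine and flips under `u`, while every member of the family `F` is
`u`-invariant, then any translation `w` can be replaced by `w` or `w ⊕ u` so as to FIX `L`, without changing its action on the family.
[folklore] -/
theorem kh_dual_adjust {ι : Type*} (L : (Fin m → Bool) → Bool) (hL : IsDegLeFun 1 L) (u : Fin m → Bool)
    (hLu : ∀ x, L (bxor x u) = !L x) (F : ι → (Fin m → Bool) → Bool) (hFu : ∀ i x, F i (bxor x u) = F i x)
    (w : Fin m → Bool) :
    ∃ w' : Fin m → Bool, (∀ x, L (bxor x w') = L x) ∧ ∀ i x, F i (bxor x w') = F i (bxor x w) := by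
  obtain ⟨ε, hε⟩ := kh_affine_shift L hL w
  cases ε
  · exact ⟨w, fun x => by rw [hε, Bool.xor_false], fun i x => rfl⟩
  · refine ⟨bxor w u, fun x => ?_, fun i x => ?_⟩
    · rw [← iw_bxor_assoc, hLu, hε]; cases L x <;> rfl
    · rw [← iw_bxor_assoc, hFu]

end Summit.QuantumAdvantage.QuantumAdvantage.Theorems.CubicForrelation.NearExactIsExact

end
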